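import Summits.RiemannHypothesis.RiemannHypothesis.Theorems.SuzukiFlowPairingWeilSide
import Literature.NumberTheory.LFunctions.WeilMellinInversion

/-!
# The Weil side of `FlowPairing`, evaluated: `weilQuadratic` of a θ-flow window output as `x`-side
# integrals of its autocorrelation (column DBR; RH-FREE)

RH-FREE throughout; nothing here bears on the truth of RH.  Completion of `Theorems.SuzukiFlowPairingWeilSide`:
for `θ > 1`, a window `(−t,t)`, `f ∈ L¹(−t,t)`, `g_θ = winOut θ t f`, `φ = g_θ ⋆ g̃_θ`,

* `weilPolarTerm_eq_integral_Ioi` — `φ̂(0) + φ̂(1) = ∫₀^∞ (φ(x)+φ(−x))(e^{−x/2}+e^{x/2}) dx` for any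
  continuous compactly supported `φ` (the tree's `integral_Ioi_add_comp_neg_mul_polarWeight` without smoothness);
* **`weilQuadratic_winOut_eq`** — `weilQuadratic g_θ = weilFunctional φ` written entirely in absolutely
  convergent `x`-side quantities of `φ`: polar folding, the prime sum, and the archimedean series
  `Σₙ (4πφ(0)/(n+1) − 4π∫₀^∞(φ(x)+φ(−x))e^{−(2n+½)x}dx) = 2·weilArchIntegral φ + 4πγφ(0)`
  (`hasSum_weilArchIntegral_winOut`).

With the pairing lemma (`Theorems.SuzukiFlowPairingCausality`) every `φ`-quantity here is a window pairing
`∫_{(−t,t)} (𝖪_θ[t]f)(x)(𝖪_θ[t]f)(x − v) dx`; `FlowPairing` is thereby reduced to the operator-side identity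
`2⟨𝖪_θ[t]f, 𝒥_θ[t]f⟩ = −2·Re` of this value (Fubini swaps of `J_θ = k ∗ K_θ`,
`invFourierLine_flowSymbol_mul_limTheta_explicit`).

References: [Su20] M. Suzuki, ASPM 84 (2020); E. Bombieri, Rend. Lincei (9) 11 (2000), §2.
-/

noncomputable section

-- D-0017: `Summit.<S>.<S>.…` is the designed namespace of a single-problem summit.
set_option linter.dupNamespace false

open Complex MeasureTheory Set Filter Topology
open scoped Real

namespace Summit.RiemannHypothesis.RiemannHypothesis.Theorems.SuzukiThetaFlow

open Literature.NumberTheory.LFunctions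
open Summit.RiemannHypothesis.RiemannHypothesis.Theorems.SuzukiKernelSemigroup
open Summit.RiemannHypothesis.RiemannHypothesis.Theorems.SuzukiFlowPairing

variable {θ t : ℝ} {f : ℝ → ℝ}

/-! ## §4 The polar term by folding, and the value of `weilQuadratic g_θ` -/

/-- RH-FREE.  **Polar term of a continuous compactly supported test function, folded onto `(0,∞)`**:
`weilPolarTerm φ = φ̂(0) + φ̂(1) = ∫₀^∞ (φ(x) + φ(−x))(e^{−x/2} + e^{x/2}) dx` (the tree's
`integral_Ioi_add_comp_neg_mul_polarWeight`, whose proof uses only continuity and compact support). -/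
theorem weilPolarTerm_eq_integral_Ioi {φ : ℝ → ℂ} (hc : Continuous φ) (hs : HasCompactSupport φ) :
    weilPolarTerm φ = ∫ x in Ioi (0 : ℝ), (φ x + φ (-x)) * (cexp (-(x : ℂ) / 2) + cexp ((x : ℂ) / 2)) := by
  have hgw : Integrable fun x : ℝ ↦ φ x * (cexp (-(x : ℂ) / 2) + cexp ((x : ℂ) / 2)) :=
    (hc.mul (by fun_prop)).integrable_of_hasCompactSupport hs.mul_right
  rw [integral_Ioi_add_comp_neg_mul_eq (fun x ↦ by push_cast; ring_nf) hgw]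
  unfold weilPolarTerm weilMellin
  rw [← integral_add (integrable_weilIntegrand hc hs 0) (integrable_weilIntegrand hc hs 1)]
  congr 1 with x
  have e1 : ((0 : ℂ) - 1 / 2) * x = -(x : ℂ) / 2 := by ring
  have e2 : ((1 : ℂ) - 1 / 2) * x = (x : ℂ) / 2 := by ring
  rw [e1, e2]
  ring

/-- **RH-FREE · THE WEIL SIDE OF `FlowPairing`, EVALUATED**: for `θ > 1`, a window `(−t,t)`, `f ∈ L¹(−t,t)`,
`g_θ = winOut θ t f` and `φ = g_θ ⋆ g̃_θ`,
`weilQuadratic g_θ = ∫₀^∞ (φ(x)+φ(−x))(e^{−x/2}+e^{x/2}) dx − weilPrimeTerm φ`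
`  + ((1/2π)·(S − 4πγ φ(0))/2 − φ(0) log π)`,
`S = Σₙ (4π φ(0)/(n+1) − 4π ∫₀^∞ (φ(x)+φ(−x)) e^{−(2n+½)x} dx)` — every term an absolutely convergent
`x`-side quantity of `φ` (polar folding, `hasSum_weilArchIntegral_winOut`).  What is left of `FlowPairing`
is the operator-side identity `2⟨𝖪_θ[t]f, 𝒥_θ[t]f⟩ = −2·Re` of this value.  Nothing here bears on RH. -/
theorem weilQuadratic_winOut_eq (hθ : 1 < θ) (hf : IntegrableOn f (Ioo (-t) t)) :
    weilQuadratic (winOut θ t f) =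
      (∫ x in Ioi (0 : ℝ), (weilConv (winOut θ t f) (weilReflect (winOut θ t f)) x +
          weilConv (winOut θ t f) (weilReflect (winOut θ t f)) (-x)) * (cexp (-(x : ℂ) / 2) + cexp ((x : ℂ) / 2))) -
        weilPrimeTerm (weilConv (winOut θ t f) (weilReflect (winOut θ t f))) +
      ((1 / (2 * π) : ℂ) * (((∑' n : ℕ, (4 * π * weilConv (winOut θ t f) (weilReflect (winOut θ t f)) 0 / ((n : ℂ) + 1) -
          4 * π * ∫ x in Ioi (0 : ℝ), (weilConv (winOut θ t f) (weilReflect (winOut θ t f)) x +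
            weilConv (winOut θ t f) (weilReflect (winOut θ t f)) (-x)) * cexp ((-(2 * (n : ℂ)) - 1 / 2) * x))) -
          4 * π * Real.eulerMascheroniConstant * weilConv (winOut θ t f) (weilReflect (winOut θ t f)) 0) / 2) -
        weilConv (winOut θ t f) (weilReflect (winOut θ t f)) 0 * (Real.log π : ℂ)) := by
  obtain ⟨-, hS⟩ := hasSum_weilArchIntegral_winOut hθ hf
  have hAI : weilArchIntegral (weilConv (winOut θ t f) (weilReflect (winOut θ t f))) =
      ((∑' n : ℕ, (4 * π * weilConv (winOut θ t f) (weilReflect (winOut θ t f)) 0 / ((n : ℂ) + 1) -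
          4 * π * ∫ x in Ioi (0 : ℝ), (weilConv (winOut θ t f) (weilReflect (winOut θ t f)) x +
            weilConv (winOut θ t f) (weilReflect (winOut θ t f)) (-x)) * cexp ((-(2 * (n : ℂ)) - 1 / 2) * x))) -
        4 * π * Real.eulerMascheroniConstant * weilConv (winOut θ t f) (weilReflect (winOut θ t f)) 0) / 2 := by
    rw [hS.tsum_eq]
    ring
  unfold weilQuadratic weilFunctional weilArchTerm
  rw [weilPolarTerm_eq_integral_Ioi (continuous_autocorr_winOut hθ hf)
    (hasCompactSupport_weilConv_winOut_weilReflect hθ t f), hAI]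

end Summit.RiemannHypothesis.RiemannHypothesis.Theorems.SuzukiThetaFlow

end
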